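import Literature.AnabelianGeometry.AbsoluteAnabelian.Coorientations
import Literature.AnabelianGeometry.AbsoluteAnabelian.AutHolomorphicSpacesHolTypeProofs
import Literature.AnabelianGeometry.AbsoluteAnabelian.ArchimedeanHolFieldFunctorGeometricRC
import HarnessLib

/-!
# [AbsTopIII] Cor. 2.3 (i): `SameHolType` (FACT-LIST F-0080) is VOCABULARY — the two types on `ℂ`;
# its universal closure REFUTED

Proof-only companion of `Coorientations.lean` (abc-iut-L4 lineage, p406318; imported, never edited).
S. Mochizuki, *Topics in absolute anabelian geometry III*, J. Math. Sci. Univ. Tokyo 22 (2015)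
[MochizukiAbsTopIII2015], Cor. 2.3 (i) p. 53 (kurims manuscript, lit key `paper:url-5493eb38cbb7`):
"there exist precisely two co-holomorphicizations `𝕏 → 𝕐`, corresponding to the holomorphic and
anti-holomorphic local isomorphisms".  Cell abc-iut, block F (fact-proving wave), seat abc-iut-f-094,
FACT-LIST tranche 94.

**F-0080 `SameHolType φ₁ φ₂`** ("both holomorphic at every point, or both anti-holomorphic at every
point") is a 2-place PREDICATE — the vocabulary in which the second sentence of Cor. 2.3 (i) is typed
(`TwoCoHolomorphicizations`, F-0081, and abc-iut-w5-d231's `OrnFunctor.isCoOriented_iff_sameHolType` in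
`CoorientationsProofs.lean`: co-oriented ⟺ same type, which is where the row's "conditional" label comes
from) — not a fact.  Kernel certificate of that reading, on the complex plane:

* both types OCCUR: `sameHolType_id_id` (identity/identity: the holomorphic type),
  `sameHolType_conj_conj` (conjugation/conjugation: the anti-holomorphic type);
* they are DISTINCT: `not_sameHolType_id_conj` (identity vs complex conjugation — exclusivity of the two
  types for homeomorphisms of Riemann surfaces, abc-iut's `not_isHolAt_and_isAntiHolAt`, and
  `HolRS.isAntiHolAt_conj`, both cited BY NAME);
* hence `not_forall_sameHolType` (**F-0080, universal closure REFUTED**, universe `0`), with the general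
  form `not_sameHolType_of_isHolAt_of_isAntiHolAt` (a homeomorphism holomorphic somewhere and one
  anti-holomorphic somewhere are never of the same type) and the bookkeeping `SameHolType.symm`,
  `sameHolType_of_forall_isHolAt` / `sameHolType_of_forall_isAntiHolAt` (the two instance forms).

Consequence of record: the row is consumable only in instance form (`SameHolType φ₁ φ₂` for NAMED maps,
as the landed iff does); nothing is assumed under this name anywhere in the tree.

HONEST FRAMING: statements about OUR typed predicate; refereed results typed statements-first (D-0014);
typed ≠ proved; nothing here bears on the disputed [IUTchIII] Cor. 3.12; no side taken.
-/

noncomputable section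

namespace Literature.AnabelianGeometry.AbsoluteAnabelian

universe u

open _root_.TopologicalSpace _root_.Topology
open scoped _root_.Manifold _root_.ContDiff ComplexConjugate

/-! ### Bookkeeping: symmetry and the two instance forms -/

section General

variable {X₁ X₂ Y : Type u} [TopologicalSpace X₁] [ChartedSpace ℂ X₁] [TopologicalSpace X₂]
  [ChartedSpace ℂ X₂] [TopologicalSpace Y] [ChartedSpace ℂ Y]

/-- "Of the same type" is symmetric. [cite: MochizukiAbsTopIII2015, Corollary 2.3 (i) p.53] -/
theorem SameHolType.symm {φ₁ : X₁ → Y} {φ₂ : X₂ → Y} (h : SameHolType φ₁ φ₂) : SameHolType φ₂ φ₁ :=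
  h.imp (fun h' => ⟨h'.2, h'.1⟩) fun h' => ⟨h'.2, h'.1⟩

/-- Instance form (holomorphic type): two everywhere-holomorphic maps are of the same type.
[cite: MochizukiAbsTopIII2015, Corollary 2.3 (i) p.53] -/
theorem sameHolType_of_forall_isHolAt {φ₁ : X₁ → Y} {φ₂ : X₂ → Y} (h₁ : ∀ x, IsHolAt φ₁ x)
    (h₂ : ∀ x, IsHolAt φ₂ x) : SameHolType φ₁ φ₂ :=
  Or.inl ⟨h₁, h₂⟩

/-- Instance form (anti-holomorphic type): two everywhere-anti-holomorphic maps are of the same type.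
[cite: MochizukiAbsTopIII2015, Corollary 2.3 (i) p.53] -/
theorem sameHolType_of_forall_isAntiHolAt {φ₁ : X₁ → Y} {φ₂ : X₂ → Y} (h₁ : ∀ x, IsAntiHolAt φ₁ x)
    (h₂ : ∀ x, IsAntiHolAt φ₂ x) : SameHolType φ₁ φ₂ :=
  Or.inr ⟨h₁, h₂⟩

end General

/-! ### The two types exclude each other -/

section Exclusive

variable {X₁ X₂ Y : Type u} [TopologicalSpace X₁] [ChartedSpace ℂ X₁] [IsManifold 𝓘(ℂ, ℂ) ω X₁]
  [TopologicalSpace X₂] [ChartedSpace ℂ X₂] [IsManifold 𝓘(ℂ, ℂ) ω X₂]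
  [TopologicalSpace Y] [ChartedSpace ℂ Y] [IsManifold 𝓘(ℂ, ℂ) ω Y]

/-- A homeomorphism of Riemann surfaces that is holomorphic at some point and one that is
anti-holomorphic at some point are NOT of the same type (no homeomorphism is both holomorphic and
anti-holomorphic at a point: `not_isHolAt_and_isAntiHolAt`).
[cite: MochizukiAbsTopIII2015, Corollary 2.3 (i) p.53] -/
theorem not_sameHolType_of_isHolAt_of_isAntiHolAt (φ₁ : X₁ ≃ₜ Y) (φ₂ : X₂ ≃ₜ Y) {x₁ : X₁} {x₂ : X₂}
    (h₁ : IsHolAt (⇑φ₁) x₁) (h₂ : IsAntiHolAt (⇑φ₂) x₂) : ¬ SameHolType (⇑φ₁) (⇑φ₂) := by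
  rintro (⟨-, h⟩ | ⟨h, -⟩)
  · exact not_isHolAt_and_isAntiHolAt φ₂ x₂ ⟨h x₂, h₂⟩
  · exact not_isHolAt_and_isAntiHolAt φ₁ x₁ ⟨h₁, h x₁⟩

end Exclusive

/-! ### On the complex plane: both types occur and are distinct; F-0080's universal closure is false -/

/-- The identity of the complex plane is holomorphic at every point.
[cite: MochizukiAbsTopIII2015, Definition 2.1 (ii) p.51] -/
theorem isHolAt_id_complex (z : ℂ) : IsHolAt (fun w : ℂ => w) z :=
  Filter.Eventually.of_forall fun _ => mdifferentiableAt_id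

/-- The holomorphic type occurs: identity/identity. [cite: MochizukiAbsTopIII2015, Corollary 2.3 (i) p.53] -/
theorem sameHolType_id_id : SameHolType (fun w : ℂ => w) (fun w : ℂ => w) :=
  sameHolType_of_forall_isHolAt isHolAt_id_complex isHolAt_id_complex

/-- The anti-holomorphic type occurs: complex conjugation/complex conjugation.
[cite: MochizukiAbsTopIII2015, Corollary 2.3 (i) p.53] -/
theorem sameHolType_conj_conj : SameHolType (fun w : ℂ => conj w) (fun w : ℂ => conj w) :=
  sameHolType_of_forall_isAntiHolAt HolRS.isAntiHolAt_conj HolRS.isAntiHolAt_conj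

/-- **The two types are distinct**: the identity and complex conjugation of the complex plane are NOT
of the same type. [cite: MochizukiAbsTopIII2015, Corollary 2.3 (i) p.53] -/
theorem not_sameHolType_id_conj : ¬ SameHolType (fun w : ℂ => w) (fun w : ℂ => conj w) := by
  have hconj : (fun w : ℂ => conj w) = ⇑Complex.conjCLE.toHomeomorph := by
    ext w
    simp
  have h := not_sameHolType_of_isHolAt_of_isAntiHolAt (Homeomorph.refl ℂ) Complex.conjCLE.toHomeomorph
    (x₁ := 0) (x₂ := 0) (isHolAt_id_complex 0) (by rw [← hconj]; exact HolRS.isAntiHolAt_conj 0)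
  rwa [← hconj] at h

/-- **FACT-LIST F-0080, universal closure REFUTED** (universe `0`): "`SameHolType φ₁ φ₂` for all maps of
all complex-charted spaces" fails at `φ₁ = id`, `φ₂ = conj` on `ℂ`.  `SameHolType` is the 2-place
predicate in which Cor. 2.3 (i), second sentence, is typed (`TwoCoHolomorphicizations`;
`OrnFunctor.isCoOriented_iff_sameHolType`): consumable only in instance form, never as its closure; this
refutes OUR `∀`-reading of a vocabulary row, not anything in print.
[cite: MochizukiAbsTopIII2015, Corollary 2.3 (i) p.53] -/
theorem not_forall_sameHolType :
    ¬ ∀ (X₁ X₂ Y : Type) [TopologicalSpace X₁] [ChartedSpace ℂ X₁] [TopologicalSpace X₂]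
        [ChartedSpace ℂ X₂] [TopologicalSpace Y] [ChartedSpace ℂ Y] (φ₁ : X₁ → Y) (φ₂ : X₂ → Y),
        SameHolType φ₁ φ₂ :=
  fun h => not_sameHolType_id_conj (h ℂ ℂ ℂ _ _)

end Literature.AnabelianGeometry.AbsoluteAnabelian

end
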